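import Summits.Parity.BatemanHorn.Theorems.SelbergDelangeRigidityLSDRealSegmentTailsAux2
import HarnessLib

/-!
# Route `SelbergDelangeRigidity`, crux `LSDRealSegment` (stmt-Parity-9770), line
# `product-anatomy-subcritical`: tails for ONE LINEAR FORM, part 1 (helper file of `stub_tails`)

For a Bateman–Horn system `f : Fin 1 → ℤ[X]` with `deg f₀ = 1` (`f₀ = aX + b`, `a ≥ 1`) and real `1 ≤ y < 2`,
three of the four tail clauses of `stub_tails` hold UNCONDITIONALLY (`tails_linear_three`, registered helper):
`APrioriBound 1 f y` (`Σ_{n ≤ x} y^{Ω(an+b)} ≤ C x (log x)^{y−1}`), `RankinTail 1 f y` (Rankin's trick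
`1[s > x^τ] ≤ (s/x^τ)^σ`, `σ = 1/(θ log x)`, on the `x^θ`-smooth part `s`, fed into the tilted engine
`tails_smoothTilt_sum_le`; the saving is `e^{−τ/θ}`) and `BalancedClassBound 1 f y` (EMPTY class: two primes
`> x^{3/4}` cannot divide one value `≤ (a+|b|)x` once `x ≥ (a+|b|)²`).  The transfer from `n ≤ x` to the values
`m = an + b ≤ ax + b` is the injectivity of `n ↦ an + b` (`sum_toNat_le_sum_Icc`).  `TopClassBound` is in the
companion file `…TailsLinear`.
-/

open Filter Finset Polynomial
open scoped BigOperators Topology Classical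

namespace Summit.Parity.BatemanHorn.Cruxes.LSDRealSegment.ProductAnatomySubcritical

open Literature.NumberTheory.Sieve
open ArithmeticFunction (cardFactors)
noncomputable section

/-! ### Elementary real bookkeeping -/

/-- For `x ≥ 2` and `0 ≤ e ≤ 1`: `1 ≤ 2 (log x)^e`. [folklore] -/
theorem one_le_two_mul_log_rpow {x : ℝ} (hx : 2 ≤ x) {e : ℝ} (he : 0 ≤ e) (he1 : e ≤ 1) :
    1 ≤ 2 * Real.log x ^ e := by
  have hlog2 : (1 : ℝ) / 2 < Real.log 2 := by
    have := Real.log_two_gt_d9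
    linarith
  have hl : Real.log 2 ≤ Real.log x := Real.log_le_log two_pos hx
  have hl0 : 0 < Real.log x := by linarith
  rcases le_or_gt 1 (Real.log x) with h1 | h1
  · have : 1 ≤ Real.log x ^ e := Real.one_le_rpow h1 he
    linarith
  · have : Real.log x ^ (1 : ℝ) ≤ Real.log x ^ e := Real.rpow_le_rpow_of_exponent_ge hl0 h1.le he1
    rw [Real.rpow_one] at this
    linarith

/-- Comparison of scales: for `x ≥ 2` and `M ≤ L x`, `M (log M)^e ≤ c_{L,e} · x (log x)^e`. [folklore] -/
theorem exists_mul_log_rpow_le (L : ℕ) {e : ℝ} (he : 0 ≤ e) :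
    ∃ c : ℝ, 0 < c ∧ ∀ x M : ℕ, 2 ≤ x → M ≤ L * x →
      (M : ℝ) * Real.log M ^ e ≤ c * ((x : ℝ) * Real.log x ^ e) := by
  set κ : ℝ := 1 + Real.log L / Real.log 2 with hκ
  have hL0 : (0 : ℝ) ≤ Real.log L := Real.log_natCast_nonneg L
  have hκ1 : 1 ≤ κ := by
    have : 0 ≤ Real.log L / Real.log 2 := div_nonneg hL0 (Real.log_nonneg one_le_two)
    linarith
  refine ⟨(L + 1) * κ ^ e, by positivity, ?_⟩
  intro x M hx hM
  have hx0 : (0 : ℝ) < x := by exact_mod_cast (show 0 < x by omega)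
  have hlog2 : 0 < Real.log 2 := Real.log_pos one_lt_two
  have hlx : Real.log 2 ≤ Real.log x := Real.log_le_log two_pos (by exact_mod_cast hx)
  have hlx0 : 0 ≤ Real.log x := hlog2.le.trans hlx
  rcases Nat.eq_zero_or_pos M with rfl | hM0
  · simp only [Nat.cast_zero, zero_mul]
    positivity
  have hM0' : (0 : ℝ) < M := by exact_mod_cast hM0
  have hMle : (M : ℝ) ≤ L * x := by exact_mod_cast hM
  have hL1 : 0 < L := Nat.pos_of_ne_zero fun h => by rw [h, zero_mul] at hM; omega
  have hlogM : Real.log M ≤ κ * Real.log x := by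
    calc Real.log M ≤ Real.log (L * x) := Real.log_le_log hM0' hMle
      _ = Real.log L + Real.log x := Real.log_mul (by positivity) hx0.ne'
      _ ≤ (Real.log L / Real.log 2) * Real.log x + Real.log x := by
          have : Real.log L ≤ Real.log L / Real.log 2 * Real.log x := by
            rw [div_mul_eq_mul_div, le_div_iff₀ hlog2]
            exact mul_le_mul_of_nonneg_left hlx hL0
          linarith
      _ = κ * Real.log x := by rw [hκ]; ring
  have hlogM0 : 0 ≤ Real.log M := Real.log_natCast_nonneg M
  calc (M : ℝ) * Real.log M ^ e ≤ (L * x) * (κ * Real.log x) ^ e :=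
        mul_le_mul hMle (Real.rpow_le_rpow hlogM0 hlogM he) (Real.rpow_nonneg hlogM0 _) (by positivity)
    _ = L * κ ^ e * ((x : ℝ) * Real.log x ^ e) := by
        rw [Real.mul_rpow (by positivity) hlx0]
        ring
    _ ≤ (L + 1) * κ ^ e * ((x : ℝ) * Real.log x ^ e) := by
        gcongr
        linarith

/-- `e^{−R} K ≤ ε` for `R = K/ε` (`K, ε > 0`). [folklore] -/
theorem exp_neg_mul_le {K ε R : ℝ} (hK : 0 < K) (hε : 0 < ε) (hR : K / ε ≤ R) : Real.exp (-R) * K ≤ ε := by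
  have h1 : Real.exp (-R) ≤ Real.exp (-(K / ε)) := Real.exp_le_exp.mpr (by linarith)
  have h2 : K / ε + 1 ≤ Real.exp (K / ε) := Real.add_one_le_exp _
  have h3 : Real.exp (-(K / ε)) ≤ ε / (K + ε) := by
    rw [Real.exp_neg, inv_eq_one_div, div_le_div_iff₀ (Real.exp_pos _) (by positivity)]
    calc 1 * (K + ε) = ε * (K / ε + 1) := by field_simp
      _ ≤ ε * Real.exp (K / ε) := mul_le_mul_of_nonneg_left h2 hε.le
  calc Real.exp (-R) * K ≤ ε / (K + ε) * K := mul_le_mul_of_nonneg_right (h1.trans h3) hK.le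
    _ ≤ ε := by
        rw [div_mul_eq_mul_div, div_le_iff₀ (by positivity)]
        nlinarith

/-! ### Transfer from `n ≤ x` to the values `m = an + b` -/

/-- Injectivity of `n ↦ an + b` (`a ≥ 1`): a non-negative weight summed over `n ∈ S ⊆ [0, x]` with
`an + b ≥ 1` is at most its sum over `1 ≤ m ≤ ax + b`. [folklore] -/
theorem sum_toNat_le_sum_Icc {a b : ℤ} (ha : 0 < a) {x : ℕ} {S : Finset ℕ} (hS : ∀ n ∈ S, n ≤ x)
    (hpos : ∀ n ∈ S, 1 ≤ a * n + b) {g : ℕ → ℝ} (hg : ∀ m, 0 ≤ g m) :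
    ∑ n ∈ S, g (a * n + b).toNat ≤ ∑ m ∈ Icc 1 (a * x + b).toNat, g m := by
  have hinj : Set.InjOn (fun n : ℕ => (a * n + b).toNat) S := by
    intro n hn n' hn' h
    have h1 := hpos n hn
    have h2 := hpos n' hn'
    have h' : ((a * n + b).toNat : ℤ) = ((a * n' + b).toNat : ℤ) := by exact_mod_cast h
    rw [Int.toNat_of_nonneg (by omega), Int.toNat_of_nonneg (by omega)] at h'
    have h3 : a * (n : ℤ) = a * (n' : ℤ) := by linarith
    exact_mod_cast mul_left_cancel₀ ha.ne' h3
  rw [← Finset.sum_image hinj]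
  refine Finset.sum_le_sum_of_subset_of_nonneg (fun m hm => ?_) (fun m _ _ => hg m)
  rw [Finset.mem_image] at hm
  obtain ⟨n, hn, rfl⟩ := hm
  have h1 := hpos n hn
  have h2 : (n : ℤ) ≤ x := by exact_mod_cast hS n hn
  have h3 : a * n + b ≤ a * x + b := by nlinarith
  exact Finset.mem_Icc.mpr ⟨by omega, Int.toNat_le_toNat h3⟩

/-! ### One linear form -/

section Linear

variable {f : Fin 1 → ℤ[X]}

/-- A Bateman–Horn system of one linear form is `f₀ = aX + b` with `a ≥ 1`. [folklore] -/
theorem exists_eval_eq_linear (hf : IsBatemanHornSystem f) (h1 : (f 0).natDegree = 1) :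
    ∃ a b : ℤ, 0 < a ∧ ∀ n : ℕ, (f 0).eval (n : ℤ) = a * n + b := by
  refine ⟨(f 0).coeff 1, (f 0).coeff 0, ?_, fun n => ?_⟩
  · have := hf.leadingCoeff_pos 0
    rwa [Polynomial.leadingCoeff, h1] at this
  · conv_lhs => rw [Polynomial.eq_X_add_C_of_natDegree_le_one (le_of_eq h1)]
    simp

/-- `Ω_f(n) = Ω(f₀(n).toNat)` for `k = 1`. [folklore] -/
theorem stat_fin_one (f : Fin 1 → ℤ[X]) (n : ℕ) : stat f n = cardFactors (((f 0).eval (n : ℤ)).toNat) := by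
  rw [stat, Fin.sum_univ_one]

/-- `P(n) = val f 0 n` for `k = 1`. [folklore] -/
theorem prodVal_fin_one (f : Fin 1 → ℤ[X]) (n : ℕ) : prodVal f n = val f 0 n := by
  rw [prodVal, Fin.prod_univ_one, val]

variable {a b : ℤ}

/-- `(ax + b).toNat ≤ (a + |b|) x` for `x ≥ 1`. [folklore] -/
theorem toNat_le_mul (ha : 0 < a) {x : ℕ} (hx : 1 ≤ x) : (a * x + b).toNat ≤ (a.toNat + b.natAbs) * x := by
  rw [Int.toNat_le]
  push_cast
  rw [Int.toNat_of_nonneg ha.le]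
  have h1 : b ≤ |b| := le_abs_self b
  have hx' : (1 : ℤ) ≤ x := by exact_mod_cast hx
  have h2 : |b| ≤ |b| * x := le_mul_of_one_le_right (abs_nonneg b) hx'
  nlinarith

/-- **APrioriBound for one linear form**: `Σ_{n ≤ x} y^{Ω(an+b)} ≤ C x (log x)^{y−1}` (`x ≥ 2`). [folklore] -/
theorem aPrioriBound_linear (ha : 0 < a) (heval : ∀ n : ℕ, (f 0).eval (n : ℤ) = a * n + b) {y : ℝ}
    (hy : 1 ≤ y) (hy2 : y < 2) : APrioriBound 1 f y := by
  obtain ⟨C, σ₀, hσ₀, hC⟩ := tails_smoothTilt_sum_le y hy hy2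
  have hA : ∀ N : ℕ, 2 ≤ N → ∑ m ∈ Icc 1 N, y ^ cardFactors m ≤ max C 0 * ((N : ℝ) * Real.log N ^ (y - 1)) := by
    intro N hN
    have h := hC 2 0 N le_rfl le_rfl hσ₀.le (by simp) hN
    simp only [Real.rpow_zero, mul_one] at h
    refine h.trans (mul_le_mul_of_nonneg_right (le_max_left _ _) ?_)
    have : (0 : ℝ) ≤ Real.log N := Real.log_natCast_nonneg N
    positivity
  set L : ℕ := a.toNat + b.natAbs with hL
  obtain ⟨c, hc0, hc⟩ := exists_mul_log_rpow_le L (show 0 ≤ y - 1 by linarith)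
  set K₀ : ℕ := (-b).toNat + 1 with hK₀
  refine ⟨2 * ((K₀ : ℝ) + 1) + max C 0 * c, fun x hx => ?_⟩
  have hx1 : 1 ≤ x := by omega
  set Φ : ℝ := (x : ℝ) * Real.log x ^ (((1 : ℕ) : ℝ) * (y - 1)) with hΦ
  have hΦ' : Φ = (x : ℝ) * Real.log x ^ (y - 1) := by rw [hΦ, Nat.cast_one, one_mul]
  have hΦ1 : 1 ≤ 2 * Φ := by
    have h2 := one_le_two_mul_log_rpow (show (2 : ℝ) ≤ x by exact_mod_cast hx) (show 0 ≤ y - 1 by linarith)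
      (by linarith)
    have hx1' : (1 : ℝ) ≤ x := by exact_mod_cast hx1
    have h0 : 0 ≤ Real.log x ^ (y - 1) := Real.rpow_nonneg (Real.log_natCast_nonneg x) _
    rw [hΦ']
    nlinarith
  have hΦ0 : 0 ≤ Φ := by linarith
  rw [← Finset.sum_filter_add_sum_filter_not (range (x + 1)) (fun n : ℕ => 1 ≤ a * n + b)]
  -- the rows with `an + b ≥ 1`
  have hP : ∑ n ∈ (range (x + 1)).filter (fun n : ℕ => 1 ≤ a * n + b), y ^ stat f n ≤
      ∑ m ∈ Icc 1 (a * x + b).toNat, y ^ cardFactors m := by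
    rw [Finset.sum_congr rfl fun n _ => by rw [stat_fin_one, heval]]
    exact sum_toNat_le_sum_Icc ha (g := fun m => y ^ cardFactors m)
      (fun n hn => by have := Finset.mem_range.mp (Finset.mem_filter.mp hn).1; omega)
      (fun n hn => (Finset.mem_filter.mp hn).2) (fun m => by positivity)
  -- the rows with `an + b ≤ 0` (weight `y⁰ = 1`, at most `K₀` of them)
  have hN : ∑ n ∈ (range (x + 1)).filter (fun n : ℕ => ¬1 ≤ a * n + b), y ^ stat f n ≤ K₀ := by
    rw [Finset.sum_congr rfl fun n hn => by
      rw [stat_fin_one, heval, show (a * n + b).toNat = 0 by have := (Finset.mem_filter.mp hn).2; omega,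
        ArithmeticFunction.map_zero, pow_zero]]
    rw [Finset.sum_const, nsmul_eq_mul, mul_one]
    have hsub : (range (x + 1)).filter (fun n : ℕ => ¬1 ≤ a * n + b) ⊆ range K₀ := by
      intro n hn
      have h := (Finset.mem_filter.mp hn).2
      have : (n : ℤ) ≤ a * n := le_mul_of_one_le_left (by positivity) (by omega)
      rw [Finset.mem_range]
      omega
    exact_mod_cast (Finset.card_le_card hsub).trans (Finset.card_range K₀).le
  -- the value sum
  have hM : ∑ m ∈ Icc 1 (a * x + b).toNat, y ^ cardFactors m ≤ 1 + max C 0 * c * Φ := by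
    have hMc : 0 ≤ max C 0 * c * Φ := by positivity
    rcases lt_or_ge (a * x + b).toNat 2 with hM2 | hM2
    · have h01 : (a * x + b).toNat = 0 ∨ (a * x + b).toNat = 1 := by omega
      rcases h01 with h | h
      · rw [h]
        simp only [show Icc 1 0 = (∅ : Finset ℕ) by rfl, Finset.sum_empty]
        linarith
      · rw [h, Finset.Icc_self, Finset.sum_singleton, ArithmeticFunction.cardFactors_one, pow_zero]
        linarith
    · calc ∑ m ∈ Icc 1 (a * x + b).toNat, y ^ cardFactors m
          ≤ max C 0 * (((a * x + b).toNat : ℝ) * Real.log ((a * x + b).toNat) ^ (y - 1)) := hA _ hM2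
        _ ≤ max C 0 * (c * Φ) := by
            rw [hΦ']
            exact mul_le_mul_of_nonneg_left (hc x _ hx (toNat_le_mul ha hx1)) (le_max_right _ _)
        _ ≤ 1 + max C 0 * c * Φ := by linarith [mul_assoc (max C 0) c Φ]
  calc ∑ n ∈ (range (x + 1)).filter (fun n : ℕ => 1 ≤ a * n + b), y ^ stat f n +
        ∑ n ∈ (range (x + 1)).filter (fun n : ℕ => ¬1 ≤ a * n + b), y ^ stat f n
      ≤ (1 + max C 0 * c * Φ) + K₀ := add_le_add (hP.trans hM) hN
    _ ≤ (2 * ((K₀ : ℝ) + 1) + max C 0 * c) * Φ := by nlinarith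

/-- **BalancedClassBound for one linear form**: the class is EMPTY for `x ≥ (a+|b|)²` with `δ = 1/4`
(two distinct primes `> x^{3/4}` dividing a value `≤ (a+|b|)x`). [folklore] -/
theorem balancedClassBound_linear (ha : 0 < a) (heval : ∀ n : ℕ, (f 0).eval (n : ℤ) = a * n + b) (y : ℝ) :
    BalancedClassBound 1 f y := by
  intro ε hε
  refine ⟨1 / 4, by norm_num, ?_⟩
  set L : ℕ := a.toNat + b.natAbs with hL
  filter_upwards [eventually_ge_atTop (max 1 (L ^ 2))] with x hx
  have hx1 : 1 ≤ x := le_of_max_le_left hx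
  have hxL : L ^ 2 ≤ x := le_of_max_le_right hx
  have hempty : (Icc 1 x).filter (fun n : ℕ => ∃ p ∈ (prodVal f n).primeFactors, ∃ q ∈ (prodVal f n).primeFactors,
      p ≠ q ∧ (x : ℝ) ^ (1 - 1 / 4 : ℝ) < (p : ℝ) ∧ (x : ℝ) ^ (1 - 1 / 4 : ℝ) < (q : ℝ)) = ∅ := by
    refine Finset.filter_false_of_mem fun n hn => ?_
    rintro ⟨p, hp, q, hq, hpq, hxp, hxq⟩
    have hnx : n ≤ x := (Finset.mem_Icc.mp hn).2
    -- the value is at most `L x`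
    have hval : prodVal f n ≤ L * x := by
      rw [prodVal_fin_one, val, heval]
      refine max_le ((Int.toNat_le_toNat (by nlinarith : a * n + b ≤ a * x + b)).trans (toNat_le_mul ha hx1)) ?_
      calc 1 ≤ L := by omega
        _ ≤ L * x := Nat.le_mul_of_pos_right L hx1
    -- `p q ∣ P(n)`, so `p q ≤ L x`
    have hp' := Nat.prime_of_mem_primeFactors hp
    have hq' := Nat.prime_of_mem_primeFactors hq
    have hdvd : p * q ∣ prodVal f n :=
      Nat.Coprime.mul_dvd_of_dvd_of_dvd ((Nat.coprime_primes hp' hq').mpr hpq) (Nat.dvd_of_mem_primeFactors hp)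
        (Nat.dvd_of_mem_primeFactors hq)
    have hpq_le : p * q ≤ L * x := (Nat.le_of_dvd (Nat.pos_of_ne_zero (prodVal_ne_zero f n)) hdvd).trans hval
    -- but `p q > x^{3/2} ≥ L x`
    have hx0 : (0 : ℝ) ≤ x := Nat.cast_nonneg x
    have h34 : (x : ℝ) ^ (1 - 1 / 4 : ℝ) * (x : ℝ) ^ (1 - 1 / 4 : ℝ) = (x : ℝ) * (x : ℝ) ^ (1 / 2 : ℝ) := by
      rw [← Real.rpow_add' hx0 (by norm_num), ← Real.rpow_one_add' hx0 (by norm_num)]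
      norm_num
    have hsqrt : (L : ℝ) ≤ (x : ℝ) ^ (1 / 2 : ℝ) := by
      have : ((L : ℝ) ^ 2) ^ (1 / 2 : ℝ) ≤ ((x : ℝ)) ^ (1 / 2 : ℝ) :=
        Real.rpow_le_rpow (by positivity) (by exact_mod_cast hxL) (by norm_num)
      rwa [← Real.rpow_natCast, ← Real.rpow_mul (Nat.cast_nonneg L), show ((2 : ℕ) : ℝ) * (1 / 2 : ℝ) = 1 by norm_num,
        Real.rpow_one] at this
    have hlt : (L : ℝ) * x < p * q := by
      calc (L : ℝ) * x ≤ (x : ℝ) ^ (1 / 2 : ℝ) * x := mul_le_mul_of_nonneg_right hsqrt hx0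
        _ = (x : ℝ) ^ (1 - 1 / 4 : ℝ) * (x : ℝ) ^ (1 - 1 / 4 : ℝ) := by rw [h34]; ring
        _ < p * q := mul_lt_mul'' hxp hxq (Real.rpow_nonneg hx0 _) (Real.rpow_nonneg hx0 _)
    have : (p * q : ℕ) ≤ ((L * x : ℕ) : ℝ) := by exact_mod_cast hpq_le
    push_cast at this
    linarith
  rw [hempty, Finset.sum_empty]
  have : (0 : ℝ) ≤ Real.log x ^ (((1 : ℕ) : ℝ) * (y - 1)) := Real.rpow_nonneg (Real.log_natCast_nonneg x) _
  positivity

/-- **RankinTail for one linear form**: Rankin's trick `1[s > x^τ] ≤ e^{−τ/θ} s^σ`, `σ = 1/(θ log x)`, on the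
`x^θ`-smooth part `s` of `an + b`, and the tilted engine at `z = x^θ` (uniform in `θ`); the saving `e^{−τ/θ} ≤ e^{−R}`
gives `R = K/ε`. [folklore] -/
theorem rankinTail_linear (ha : 0 < a) (heval : ∀ n : ℕ, (f 0).eval (n : ℤ) = a * n + b) {y : ℝ}
    (hy : 1 ≤ y) (hy2 : y < 2) : RankinTail 1 f y := by
  intro ε hε
  obtain ⟨C, σ₀, hσ₀, hC⟩ := tails_smoothTilt_sum_le y hy hy2
  set L : ℕ := a.toNat + b.natAbs with hL
  obtain ⟨c, hc0, hc⟩ := exists_mul_log_rpow_le L (show 0 ≤ y - 1 by linarith)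
  set K : ℝ := max (max C 0 * c) 1 with hK
  have hK0 : 0 < K := lt_of_lt_of_le one_pos (le_max_right _ _)
  refine ⟨K / ε, by positivity, ?_⟩
  intro θ τ hθ hRθ hτ1
  have hτ0 : 0 < τ := lt_of_lt_of_le (by positivity) hRθ
  have ev1 : ∀ᶠ x : ℕ in atTop, (2 : ℝ) ≤ (x : ℝ) ^ θ :=
    ((tendsto_rpow_atTop hθ).comp tendsto_natCast_atTop_atTop).eventually_ge_atTop 2
  have ev2 : ∀ᶠ x : ℕ in atTop, 1 / (σ₀ * θ) ≤ Real.log x :=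
    (Real.tendsto_log_atTop.comp tendsto_natCast_atTop_atTop).eventually_ge_atTop _
  filter_upwards [ev1, ev2, eventually_ge_atTop (2 + b.natAbs)] with x hx1 hx2 hx3
  have hx2' : 2 ≤ x := by omega
  have hxr : (2 : ℝ) ≤ x := by exact_mod_cast hx2'
  have hxpos : (0 : ℝ) < x := by linarith
  have hlogx : 0 < Real.log x := Real.log_pos (by linarith)
  set z : ℝ := (x : ℝ) ^ θ with hz
  set σ : ℝ := 1 / (θ * Real.log x) with hσ
  have hσpos : 0 < σ := by positivity
  have hσ₀' : σ ≤ σ₀ := by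
    rw [hσ, div_le_iff₀ (by positivity)]
    rw [div_le_iff₀ (by positivity)] at hx2
    nlinarith
  have hσlog : σ * Real.log x = 1 / θ := by
    rw [hσ]
    field_simp
  have hσz : σ * Real.log z ≤ 1 := by
    rw [hz, Real.log_rpow hxpos, hσ]
    field_simp
    rfl
  have hM2 : 2 ≤ (a * x + b).toNat := by
    have : (x : ℤ) ≤ a * x := le_mul_of_one_le_left (by positivity) (by omega)
    omega
  have hsum := hC z σ (a * x + b).toNat hx1 hσpos.le hσ₀' hσz hM2
  set E : ℝ := Real.exp (-(τ / θ)) with hE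
  -- membership in the class: `an + b ≥ 1` and the Rankin inequality
  have hcls : ∀ n ∈ (Icc 1 x).filter
      (fun n : ℕ => ∃ i, (x : ℝ) ^ τ < (smoothPart ((x : ℝ) ^ θ) (val f i n) : ℝ)),
      1 ≤ a * n + b ∧ y ^ stat f n ≤
        E * (y ^ cardFactors (a * n + b).toNat * (smoothPart z (a * n + b).toNat : ℝ) ^ σ) := by
    intro n hn
    obtain ⟨i, hi⟩ := (Finset.mem_filter.mp hn).2
    rw [Subsingleton.elim i 0, val, heval] at hi
    have hx1τ : (1 : ℝ) ≤ (x : ℝ) ^ τ := Real.one_le_rpow (by linarith) hτ0.le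
    rcases lt_or_ge (a * n + b) 1 with hneg | hpos
    · exfalso
      rw [show (a * n + b).toNat = 0 by omega, max_eq_right zero_le_one, smoothPart_one, Nat.cast_one] at hi
      linarith
    refine ⟨hpos, ?_⟩
    rw [max_eq_left (by omega : 1 ≤ (a * n + b).toNat)] at hi
    rw [stat_fin_one, heval]
    have h1 : 1 ≤ E * (smoothPart z (a * n + b).toNat : ℝ) ^ σ := by
      have hxs : ((x : ℝ) ^ τ) ^ σ ≤ (smoothPart z (a * n + b).toNat : ℝ) ^ σ :=
        Real.rpow_le_rpow (by positivity) hi.le hσpos.le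
      have hxe : ((x : ℝ) ^ τ) ^ σ = Real.exp (τ / θ) := by
        rw [← Real.rpow_mul hxpos.le, Real.rpow_def_of_pos hxpos]
        congr 1
        calc Real.log x * (τ * σ) = τ * (σ * Real.log x) := by ring
          _ = τ / θ := by rw [hσlog]; ring
      calc (1 : ℝ) = E * Real.exp (τ / θ) := by rw [hE, ← Real.exp_add]; simp
        _ ≤ E * (smoothPart z (a * n + b).toNat : ℝ) ^ σ := by
            rw [← hxe]
            exact mul_le_mul_of_nonneg_left hxs (Real.exp_pos _).le
    have hw : 0 ≤ y ^ cardFactors (a * n + b).toNat := by positivity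
    calc y ^ cardFactors (a * n + b).toNat = y ^ cardFactors (a * n + b).toNat * 1 := (mul_one _).symm
      _ ≤ y ^ cardFactors (a * n + b).toNat * (E * (smoothPart z (a * n + b).toNat : ℝ) ^ σ) :=
          mul_le_mul_of_nonneg_left h1 hw
      _ = E * (y ^ cardFactors (a * n + b).toNat * (smoothPart z (a * n + b).toNat : ℝ) ^ σ) := by ring
  -- `E K ≤ ε` from `τ/θ ≥ K/ε`
  have hEK : E * K ≤ ε := by
    have : K / ε ≤ τ / θ := by
      rw [le_div_iff₀ hθ]
      linarith
    exact exp_neg_mul_le hK0 hε this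
  have hΦ0 : 0 ≤ (x : ℝ) * Real.log x ^ (y - 1) := by
    have : 0 ≤ Real.log x ^ (y - 1) := Real.rpow_nonneg hlogx.le _
    positivity
  refine (Finset.sum_le_sum fun n hn => (hcls n hn).2).trans ?_
  rw [← Finset.mul_sum]
  calc E * ∑ n ∈ (Icc 1 x).filter (fun n : ℕ => ∃ i, (x : ℝ) ^ τ < (smoothPart ((x : ℝ) ^ θ) (val f i n) : ℝ)),
        y ^ cardFactors (a * n + b).toNat * (smoothPart z (a * n + b).toNat : ℝ) ^ σ
      ≤ E * ∑ m ∈ Icc 1 (a * x + b).toNat, y ^ cardFactors m * (smoothPart z m : ℝ) ^ σ := by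
        refine mul_le_mul_of_nonneg_left (sum_toNat_le_sum_Icc ha (fun n hn => ?_) (fun n hn => (hcls n hn).1)
          (g := fun m => y ^ cardFactors m * (smoothPart z m : ℝ) ^ σ) (fun m => ?_)) (Real.exp_pos _).le
        · exact (Finset.mem_Icc.mp (Finset.mem_filter.mp hn).1).2
        · have : 0 ≤ (smoothPart z m : ℝ) ^ σ := Real.rpow_nonneg (Nat.cast_nonneg _) _
          positivity
    _ ≤ E * (C * (((a * x + b).toNat : ℝ) * Real.log ((a * x + b).toNat) ^ (y - 1))) :=
        mul_le_mul_of_nonneg_left hsum (Real.exp_pos _).le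
    _ ≤ E * (max C 0 * (c * ((x : ℝ) * Real.log x ^ (y - 1)))) := by
        refine mul_le_mul_of_nonneg_left ?_ (Real.exp_pos _).le
        have h0 : 0 ≤ ((a * x + b).toNat : ℝ) * Real.log ((a * x + b).toNat) ^ (y - 1) := by
          have : 0 ≤ Real.log ((a * x + b).toNat) ^ (y - 1) := Real.rpow_nonneg (Real.log_natCast_nonneg _) _
          positivity
        exact (mul_le_mul_of_nonneg_right (le_max_left C 0) h0).trans
          (mul_le_mul_of_nonneg_left (hc x _ hx2' (toNat_le_mul ha (by omega))) (le_max_right _ _))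
    _ = E * (max C 0 * c) * ((x : ℝ) * Real.log x ^ (y - 1)) := by ring
    _ ≤ E * K * ((x : ℝ) * Real.log x ^ (y - 1)) := by
        gcongr
        exact le_max_left _ _
    _ ≤ ε * ((x : ℝ) * Real.log x ^ (((1 : ℕ) : ℝ) * (y - 1))) := by
        rw [Nat.cast_one, one_mul]
        exact mul_le_mul_of_nonneg_right hEK hΦ0

/-- **tails_linear_three** (registered helper of `stub_tails`, line `product-anatomy-subcritical`): for a
Bateman–Horn system of ONE LINEAR FORM and `1 ≤ y < 2`, the clauses `APrioriBound`, `RankinTail` and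
`BalancedClassBound` of `stub_tails` hold unconditionally. [folklore] -/
theorem tails_linear_three : ∀ (f : Fin 1 → ℤ[X]), IsBatemanHornSystem f → (f 0).natDegree = 1 →
    ∀ y : ℝ, 1 ≤ y → y < 2 → APrioriBound 1 f y ∧ RankinTail 1 f y ∧ BalancedClassBound 1 f y := by
  intro f hf h1 y hy hy2
  obtain ⟨a, b, ha, heval⟩ := exists_eval_eq_linear hf h1
  exact ⟨aPrioriBound_linear ha heval hy hy2, rankinTail_linear ha heval hy hy2,
    balancedClassBound_linear ha heval y⟩

end Linear

end

end Summit.Parity.BatemanHorn.Cruxes.LSDRealSegment.ProductAnatomySubcritical
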